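import Literature.NumberTheory.EllipticCurves.Curve6137TwoIsogenyDescent
import HarnessLib

/-!
# The `2`-isogeny Selmer bounds of `Y = [0, -31, 0, -2516, 0] : y² = x(x + 37)(x − 68)`: `dim₂ S(-31,-2516) ≤ 4`, `dim₂ S'(-31,-2516) ≤ 0`
# (Silverman, AEC X.4.9, Example X.4.10: the congruence method)

Topic `NumberTheory/EllipticCurves`. File zero of the RANK-`2` ISOGENY-DOOR cell of route ShaPrimaryTransfer (seat bsd-line-spt-p1;
companions `Curve346SharpDescentY`, `Curve346IsogenyRank`, `Curve346SelmerCertificatesA`/`B`, `Curve346SelmerPointClasses`, `Curve346NontrivialSha`). `Y` is a model of the curve with full rational `2`-torsion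
`X' = [0, 692, 0, 114240, 0]` (`Y = ⟨2, -272, 0, 0⟩ • X'`). Here: the curves `Y`, `Y' = [0, 62, 0, 11025, 0]`, and the upper bounds
of the descent via the `2`-isogeny `Y → Y'`: `S'(-31, -2516) = S(62, 11025) ⊆ {1}` (every other squarefree divisor class
of `11025` dies modulo a prime power in both affine charts, tree lemma `Carrier6137.not_isSoluble_padic_twoIsogenyQuartic_of_zmodPow`), and
`dim₂ S(-31, -2516) ≤ ω(2516) + 1 = 4`. Theorems only; obstruction moduli found by a plain search (0 kit).

## References

* [SilvermanAEC2009] J. H. Silverman, *AEC*, 2nd ed.: Prop. X.4.9, Example X.4.10.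
-/

noncomputable section

open scoped Classical

namespace Literature.NumberTheory.EllipticCurves

namespace Curve346

open _root_.WeierstrassCurve _root_.WeierstrassCurve.Affine

/-! ## 0. The curves `Y`, `Y'` -/

/-- `b(a² − 4b) ≠ 0` for `Y = E_{-31,-2516}`. [cite: SilvermanAEC2009, Prop. X.4.9] -/
theorem habY : (-2516 : ℤ) * ((-31 : ℤ) ^ 2 - 4 * (-2516)) ≠ 0 := by norm_num

/-- The tree's literal `E_{-31,-2516}` is `Y`. [cite: SilvermanAEC2009, Prop. X.4.9] -/
theorem lit_Y : (⟨0, ((-31 : ℤ) : ℚ), 0, ((-2516 : ℤ) : ℚ), 0⟩ : WeierstrassCurve ℚ) = ⟨0, -31, 0, -2516, 0⟩ := by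
  ext <;> push_cast <;> ring

/-- The tree's literal `E_{−2a, a²−4b}` for `(a,b) = (-31,-2516)` is `Y' = [0, 62, 0, 11025, 0]`. [cite: SilvermanAEC2009, Prop. X.4.9] -/
theorem lit_Y' :
    (⟨0, ((-2 * (-31) : ℤ) : ℚ), 0, (((-31 : ℤ) ^ 2 - 4 * (-2516) : ℤ) : ℚ), 0⟩ : WeierstrassCurve ℚ) = ⟨0, 62, 0, 11025, 0⟩ := by
  ext <;> push_cast <;> ring

/-- The half-model literal for `(a,b) = (-31,-2516)`. [cite: SilvermanAEC2009, Prop. X.4.9] -/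
private theorem lit_V₀Y :
    (⟨0, -((-31 : ℤ) : ℚ) / 2, 0, (((-31 : ℤ) : ℚ) ^ 2 - 4 * (-2516 : ℤ)) / 16, 0⟩ : WeierstrassCurve ℚ) =
      ⟨0, (31 / 2), 0, (11025 / 16), 0⟩ := by
  ext <;> push_cast <;> ring

/-- `Y = [0, -31, 0, -2516, 0]` is an elliptic curve. [cite: SilvermanAEC2009, Prop. X.4.9] -/
theorem isElliptic_Y : (⟨0, -31, 0, -2516, 0⟩ : WeierstrassCurve ℚ).IsElliptic := by
  rw [← lit_Y]; exact isElliptic_mk_of_ne_zero (F := ℚ) habY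

/-- `Y' = [0, 62, 0, 11025, 0]` is an elliptic curve. [cite: SilvermanAEC2009, Prop. X.4.9] -/
theorem isElliptic_Y' : (⟨0, 62, 0, 11025, 0⟩ : WeierstrassCurve ℚ).IsElliptic := by
  rw [← lit_Y']; exact isElliptic_mk_of_ne_zero (F := ℚ) (twoIsogenyCodomain_ne_zero habY)

/-- The half-model of `Y'` is an elliptic curve. [cite: SilvermanAEC2009, Prop. X.4.9] -/
private theorem isElliptic_V₀Y : (⟨0, (31 / 2), 0, (11025 / 16), 0⟩ : WeierstrassCurve ℚ).IsElliptic := by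
  rw [← lit_V₀Y]; exact isElliptic_halfModel habY


/-! ## 1. The sharp descent on `Y = [0, -31, 0, -2516, 0]`: rank `2`, `Ш(Y/ℚ)[2] = 0`, `t_2(Y) = 0` -/

/-- `S(62, 11025)` does not contain: `d = 3, -3, 15, -15, 21, -21, 105, -105` modulo `9`; `d = -1, -5, 7, 35` modulo `16`; `d = 5, -35` modulo `25`; `d = -7` modulo `49` (no solution of either chart modulo the stated prime power; the sharp model, other side).
[cite: SilvermanAEC2009, Example X.4.10 (the congruence method)] -/
theorem not_mem_S'_Y :
    (-1 : ℤ) ∉ twoIsogenySelmerGroup (62) (11025) ∧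
      (3 : ℤ) ∉ twoIsogenySelmerGroup (62) (11025) ∧
      (-3 : ℤ) ∉ twoIsogenySelmerGroup (62) (11025) ∧
      (5 : ℤ) ∉ twoIsogenySelmerGroup (62) (11025) ∧
      (-5 : ℤ) ∉ twoIsogenySelmerGroup (62) (11025) ∧
      (15 : ℤ) ∉ twoIsogenySelmerGroup (62) (11025) ∧
      (-15 : ℤ) ∉ twoIsogenySelmerGroup (62) (11025) ∧
      (7 : ℤ) ∉ twoIsogenySelmerGroup (62) (11025) ∧
      (-7 : ℤ) ∉ twoIsogenySelmerGroup (62) (11025) ∧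
      (21 : ℤ) ∉ twoIsogenySelmerGroup (62) (11025) ∧
      (-21 : ℤ) ∉ twoIsogenySelmerGroup (62) (11025) ∧
      (35 : ℤ) ∉ twoIsogenySelmerGroup (62) (11025) ∧
      (-35 : ℤ) ∉ twoIsogenySelmerGroup (62) (11025) ∧
      (105 : ℤ) ∉ twoIsogenySelmerGroup (62) (11025) ∧
      (-105 : ℤ) ∉ twoIsogenySelmerGroup (62) (11025) := by
  have hB : (11025 : ℤ) ≠ 0 := by norm_num
  haveI : Fact (Nat.Prime 2) := ⟨by norm_num⟩
  haveI : Fact (Nat.Prime 3) := ⟨by norm_num⟩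
  haveI : Fact (Nat.Prime 5) := ⟨by norm_num⟩
  haveI : Fact (Nat.Prime 7) := ⟨by norm_num⟩
  refine ⟨?_, ?_, ?_, ?_, ?_, ?_, ?_, ?_, ?_, ?_, ?_, ?_, ?_, ?_, ?_⟩
  · refine Carrier6137.not_mem_twoIsogenySelmerGroup_of_not_isSoluble hB 2 ?_
    rw [show (11025 : ℤ) / -1 = -11025 by norm_num]
    exact Carrier6137.not_isSoluble_padic_twoIsogenyQuartic_of_zmodPow 4 (by decide)
  · refine Carrier6137.not_mem_twoIsogenySelmerGroup_of_not_isSoluble hB 3 ?_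
    rw [show (11025 : ℤ) / 3 = 3675 by norm_num]
    exact Carrier6137.not_isSoluble_padic_twoIsogenyQuartic_of_zmodPow 2 (by decide)
  · refine Carrier6137.not_mem_twoIsogenySelmerGroup_of_not_isSoluble hB 3 ?_
    rw [show (11025 : ℤ) / -3 = -3675 by norm_num]
    exact Carrier6137.not_isSoluble_padic_twoIsogenyQuartic_of_zmodPow 2 (by decide)
  · refine Carrier6137.not_mem_twoIsogenySelmerGroup_of_not_isSoluble hB 5 ?_
    rw [show (11025 : ℤ) / 5 = 2205 by norm_num]
    exact Carrier6137.not_isSoluble_padic_twoIsogenyQuartic_of_zmodPow 2 (by decide)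
  · refine Carrier6137.not_mem_twoIsogenySelmerGroup_of_not_isSoluble hB 2 ?_
    rw [show (11025 : ℤ) / -5 = -2205 by norm_num]
    exact Carrier6137.not_isSoluble_padic_twoIsogenyQuartic_of_zmodPow 4 (by decide)
  · refine Carrier6137.not_mem_twoIsogenySelmerGroup_of_not_isSoluble hB 3 ?_
    rw [show (11025 : ℤ) / 15 = 735 by norm_num]
    exact Carrier6137.not_isSoluble_padic_twoIsogenyQuartic_of_zmodPow 2 (by decide)
  · refine Carrier6137.not_mem_twoIsogenySelmerGroup_of_not_isSoluble hB 3 ?_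
    rw [show (11025 : ℤ) / -15 = -735 by norm_num]
    exact Carrier6137.not_isSoluble_padic_twoIsogenyQuartic_of_zmodPow 2 (by decide)
  · refine Carrier6137.not_mem_twoIsogenySelmerGroup_of_not_isSoluble hB 2 ?_
    rw [show (11025 : ℤ) / 7 = 1575 by norm_num]
    exact Carrier6137.not_isSoluble_padic_twoIsogenyQuartic_of_zmodPow 4 (by decide)
  · refine Carrier6137.not_mem_twoIsogenySelmerGroup_of_not_isSoluble hB 7 ?_
    rw [show (11025 : ℤ) / -7 = -1575 by norm_num]
    exact Carrier6137.not_isSoluble_padic_twoIsogenyQuartic_of_zmodPow 2 (by decide +kernel)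
  · refine Carrier6137.not_mem_twoIsogenySelmerGroup_of_not_isSoluble hB 3 ?_
    rw [show (11025 : ℤ) / 21 = 525 by norm_num]
    exact Carrier6137.not_isSoluble_padic_twoIsogenyQuartic_of_zmodPow 2 (by decide)
  · refine Carrier6137.not_mem_twoIsogenySelmerGroup_of_not_isSoluble hB 3 ?_
    rw [show (11025 : ℤ) / -21 = -525 by norm_num]
    exact Carrier6137.not_isSoluble_padic_twoIsogenyQuartic_of_zmodPow 2 (by decide)
  · refine Carrier6137.not_mem_twoIsogenySelmerGroup_of_not_isSoluble hB 2 ?_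
    rw [show (11025 : ℤ) / 35 = 315 by norm_num]
    exact Carrier6137.not_isSoluble_padic_twoIsogenyQuartic_of_zmodPow 4 (by decide)
  · refine Carrier6137.not_mem_twoIsogenySelmerGroup_of_not_isSoluble hB 5 ?_
    rw [show (11025 : ℤ) / -35 = -315 by norm_num]
    exact Carrier6137.not_isSoluble_padic_twoIsogenyQuartic_of_zmodPow 2 (by decide)
  · refine Carrier6137.not_mem_twoIsogenySelmerGroup_of_not_isSoluble hB 3 ?_
    rw [show (11025 : ℤ) / 105 = 105 by norm_num]
    exact Carrier6137.not_isSoluble_padic_twoIsogenyQuartic_of_zmodPow 2 (by decide)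
  · refine Carrier6137.not_mem_twoIsogenySelmerGroup_of_not_isSoluble hB 3 ?_
    rw [show (11025 : ℤ) / -105 = -105 by norm_num]
    exact Carrier6137.not_isSoluble_padic_twoIsogenyQuartic_of_zmodPow 2 (by decide)

/-- A squarefree integer dividing `11025` is `±` a divisor of `105`. [cite: SilvermanAEC2009, Prop. X.4.9] -/
private theorem mem_of_dvd_bY' {d : ℤ} (hsq : Squarefree d) (hd : d ∣ (11025 : ℤ)) :
    d ∈ ({1, -1, 3, -3, 5, -5, 7, -7, 15, -15, 21, -21, 35, -35, 105, -105} : Finset ℤ) := by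
  have hrad : d ∣ 105 := by
    have h5 : d ∣ (105 : ℤ) ^ 2 := dvd_trans hd ⟨1, by norm_num⟩
    exact (hsq.dvd_pow_iff_dvd (by norm_num)).mp h5
  have h1 : d.natAbs ∣ 105 := by
    have := Int.natAbs_dvd_natAbs.mpr hrad
    simpa using this
  have h2 : d.natAbs ∈ Nat.divisors 105 := Nat.mem_divisors.mpr ⟨h1, by norm_num⟩
  rw [show Nat.divisors 105 = {1, 3, 5, 7, 15, 21, 35, 105} by decide +kernel] at h2
  simp only [Finset.mem_insert, Finset.mem_singleton] at h2 ⊢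
  rcases Int.natAbs_eq d with h | h <;> rw [h] <;>
    rcases h2 with h2 | h2 | h2 | h2 | h2 | h2 | h2 | h2 <;> simp [h2]

/-- **`S(62, 11025) ⊆ {1}`**. [cite: SilvermanAEC2009, Prop. X.4.9 and Example X.4.10] -/
theorem twoIsogenySelmerGroup'_Y_subset :
    twoIsogenySelmerGroup (62) (11025) ⊆ ({1} : Finset ℤ) := by
  intro d hd
  obtain ⟨hsq, hdvd, -⟩ := (mem_twoIsogenySelmerGroup_iff (a := 62) (by norm_num : (11025 : ℤ) ≠ 0)).mp hd
  have hmem := mem_of_dvd_bY' hsq hdvd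
  obtain ⟨hm1, h3, hm3, h5, hm5, h15, hm15, h7, hm7, h21, hm21, h35, hm35, h105, hm105⟩ := not_mem_S'_Y
  simp only [Finset.mem_insert, Finset.mem_singleton] at hmem ⊢
  rcases hmem with rfl | rfl | rfl | rfl | rfl | rfl | rfl | rfl | rfl | rfl | rfl | rfl | rfl | rfl | rfl | rfl
  · simp
  · exact absurd hd hm1
  · exact absurd hd h3
  · exact absurd hd hm3
  · exact absurd hd h5
  · exact absurd hd hm5
  · exact absurd hd h7
  · exact absurd hd hm7
  · exact absurd hd h15
  · exact absurd hd hm15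
  · exact absurd hd h21
  · exact absurd hd hm21
  · exact absurd hd h35
  · exact absurd hd hm35
  · exact absurd hd h105
  · exact absurd hd hm105

/-- `2^k ≤ 2^n` forces `k ≤ n`. [cite: SilvermanAEC2009, Prop. X.4.9] -/
private theorem le_of_two_pow_le {k n : ℕ} (h : 2 ^ k ≤ 2 ^ n) : k ≤ n :=
  (Nat.pow_le_pow_iff_right (by norm_num)).mp h

/-- **`dim₂ S(-31,-2516) ≤ 4` and `dim₂ S'(-31,-2516) ≤ 0`.** [cite: SilvermanAEC2009, Prop. X.4.9] -/
theorem twoIsogenySelmerRank_Y_add_le :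
    twoIsogenySelmerRank (-31) (-2516) ≤ 4 ∧ twoIsogenySelmerRank' (-31) (-2516) ≤ 0 := by
  constructor
  · have h := twoIsogenySelmerRank_le (-31) (b := -2516) (by norm_num)
    have h3 : (-2516 : ℤ).natAbs.primeFactors.card = 3 := by decide +kernel
    omega
  · apply le_of_two_pow_le
    rw [two_pow_twoIsogenySelmerRank'_eq_card habY, twoIsogenySelmerGroup'_eq,
      show (-2 * (-31) : ℤ) = 62 by norm_num, show ((-31 : ℤ) ^ 2 - 4 * (-2516) : ℤ) = 11025 by norm_num]
    exact (Finset.card_le_card twoIsogenySelmerGroup'_Y_subset).trans (by decide)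


end Curve346

end Literature.NumberTheory.EllipticCurves

end
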